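import Literature.AlgebraicGeometry.Motives.CurveLinearSystemOpens
import Literature.AlgebraicGeometry.RelativeSpec.SymmetricPowerNormal
import Literature.AlgebraicGeometry.Resolution.RegularLocalRingsNormal
import Literature.NumberTheory.DiophantineGeometry.FunctionFieldGenusRiemannTheoremProofs
import HarnessLib

/-!
# The morphisms of Weil's construction of the Jacobian

Let `C` be a smooth projective curve over an algebraically closed field `K` of characteristic
zero, `C⁽ᵍ⁾` its `g`-th symmetric power and `Ê(y) = Σⱼ[τⱼ]` the effective divisor of degree `g`
underlying a `K`-point `y` of `C⁽ᵍ⁾` (`CurvePlaces.liftDiv`). Weil's construction of the Jacobian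
(Milne, *Jacobian Varieties*, §7; Weil 1948) glues copies of the open `W = {ℓ(Ê) = 1} ⊆ C⁽ᵍ⁾`
along maps given by point-set recipes "`E ↦` the unique effective divisor linearly equivalent
to `E + c`". This file turns the four recipes into MORPHISMS, as instances of the master theorem
`exists_hom_symPowProj_of_family_opens` (`Motives/CurveLinearSystemMorphism`) applied to signed
families of divisors (`Motives/CurveSignedFamilies`) twisted by constants, on opens with normal
local rings (`RelativeSpec/SymmetricPowerNormal`):

* `exists_hom_translate` — `E ↦ E' ∼ E + Σ[A] − Σ[B]` on opens of `C⁽ᵍ⁾` (transition maps of the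
  charts, translations);
* `exists_hom_reflect` — `E ↦ E' ∼ −E + Σ[A] − Σ[B]` on opens of `C⁽ᵍ⁾` (the inverse);
* `exists_hom_add` — `(E, F) ↦ E'' ∼ E + F + Σ[A] − Σ[B]` on opens of `C⁽ᵍ⁾ × C⁽ᵍ⁾` (the group
  law);
* `exists_hom_symmetrize` — `(P₁, …, P_g) ↦ E' ∼ Σ[Pⱼ] + Σ[A] − Σ[B]` on opens of `Cᵍ`
  (the map `Cᵍ → J`).

Each morphism is characterised on `K`-points. Also: `exists_opens_tensor_symPowProj_pt_mem_iff_sub`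
(the open `{ℓ(Ê(y₁) − Ê(y₂) + c) ≤ n}` of `C⁽ᵍ⁾ × C⁽ᵍ⁾`), `symPowProj.algPoints_eq_of_isLinearlyEquivalent`
(`K`-points with linearly equivalent `Ê` and `ℓ = 1` coincide), `one_le_ell_of_degree_eq` (Riemann),
and the integrality / normality instances used. Everything is proved; no definitions, no named
facts.

## References

* J. S. Milne, *Jacobian Varieties*, in Cornell–Silverman (eds.), *Arithmetic Geometry* (1986),
  §3 Prop. 3.1, §5 Thm. 5.1, §7. [Milne1986JacobianVarieties]
* A. Weil, *Variétés abéliennes et courbes algébriques* (1948). [Weil1948]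
* H. Stichtenoth, *Algebraic Function Fields and Codes* (2009), Thm. 1.4.17. [Stichtenoth2009]
-/

noncomputable section

universe u

open CategoryTheory CategoryTheory.Limits AlgebraicGeometry MonoidalCategory CartesianMonoidalCategory
  TopologicalSpace
open Literature.NumberTheory.DiophantineGeometry
open Literature.NumberTheory.DiophantineGeometry.AlgFunctionField
open Literature.AlgebraicGeometry.RelativeSpec

namespace Literature.AlgebraicGeometry.Motives

open RatFn FieldPoint CartierDivisor CurvePlaces

section Maps

variable {K : Type u} [Field K] [IsAlgClosed K] [CharZero K]
  (C : SchemeOver K) [IsIntegral C.left] [SmoothOfRelativeDimension 1 C.hom] [IsProper C.hom]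
  [GeometricallyIntegral C.hom] (hC : IsProjectiveOver C) (hX : CechPseudoCoherentAt C) (g : ℕ)
  (hg : (genus K (curveBC C (strPt (K := K) K)).left.functionField : ℤ) ≤ g)

/-! #### Standing instances -/

omit [IsAlgClosed K] [CharZero K] [IsIntegral C.left] in
/-- `C⁽ᵍ⁾` is integral. [folklore] -/
theorem symPowProj.isIntegral_left : IsIntegral (symPowProj C hC g).left := by
  haveI := hC.isSeparated
  haveI : IsIntegral (powOver C.hom g) := inferInstanceAs (IsIntegral (powC C g).left)
  exact (permAction C.hom g).isIntegral_glued (exists_stableAffineOpen_mem hC.finiteSubsetsInAffineOpens)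

omit [CharZero K] [IsIntegral C.left] in
/-- `Cᵍ × Cᵍ` is integral (`K` algebraically closed). [folklore] -/
theorem isIntegral_powC_tensor_powC_left (n m : ℕ) : IsIntegral (powC C n ⊗ powC C m).left := by
  haveI := geometricallyIntegral_of_isAlgClosed (powC C n).hom
  haveI := geometricallyIntegral_of_isAlgClosed (powC C m).hom
  exact SchemeOver.isIntegral_left _

omit [CharZero K] [IsIntegral C.left] in
/-- `C × (Cⁿ × Cᵐ)` is integral (`K` algebraically closed). [folklore] -/
theorem isIntegral_tensor_powC_tensor_powC_left (n m : ℕ) :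
    IsIntegral (C ⊗ (powC C n ⊗ powC C m)).left := by
  haveI := geometricallyIntegral_of_isAlgClosed (powC C n).hom
  haveI := geometricallyIntegral_of_isAlgClosed (powC C m).hom
  exact SchemeOver.isIntegral_left _

omit [CharZero K] [IsIntegral C.left] in
/-- `C × ((Cᵍ × Cᵍ) × Cᵍ)` is integral (`K` algebraically closed). [folklore] -/
theorem isIntegral_tensor_powC3_left (n m k : ℕ) :
    IsIntegral (C ⊗ ((powC C n ⊗ powC C m) ⊗ powC C k)).left := by
  haveI := geometricallyIntegral_of_isAlgClosed (powC C n).hom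
  haveI := geometricallyIntegral_of_isAlgClosed (powC C m).hom
  haveI := geometricallyIntegral_of_isAlgClosed (powC C k).hom
  exact SchemeOver.isIntegral_left _

omit [CharZero K] [IsIntegral C.left] in
/-- `(Cᵍ × Cᵍ) × Cᵍ` is integral (`K` algebraically closed). [folklore] -/
theorem isIntegral_powC3_left (n m k : ℕ) : IsIntegral ((powC C n ⊗ powC C m) ⊗ powC C k).left := by
  haveI := geometricallyIntegral_of_isAlgClosed (powC C n).hom
  haveI := geometricallyIntegral_of_isAlgClosed (powC C m).hom
  haveI := geometricallyIntegral_of_isAlgClosed (powC C k).hom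
  exact SchemeOver.isIntegral_left _

omit [CharZero K] [IsIntegral C.left] in
/-- `C⁽ᵍ⁾ × C⁽ᵍ⁾` is integral (`K` algebraically closed). [folklore] -/
theorem isIntegral_symPowProj_tensor_left : IsIntegral (symPowProj C hC g ⊗ symPowProj C hC g).left := by
  haveI := symPowProj.isIntegral_left C hC g
  haveI := symPowProj.locallyOfFiniteType_hom C hC g
  haveI := geometricallyIntegral_of_isAlgClosed (symPowProj C hC g).hom
  exact SchemeOver.isIntegral_left _

omit [IsAlgClosed K] [CharZero K] [IsIntegral C.left] [IsProper C.hom] [GeometricallyIntegral C.hom] in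
/-- The local rings of `Cᵍ` are integrally closed (regular). [folklore] -/
theorem isIntegrallyClosed_stalk_powC (n : ℕ) (t : (powC C n).left) :
    IsIntegrallyClosed ((powC C n).left.presheaf.stalk t) := by
  haveI := smoothOfRelativeDimension_powOver_base C.hom 1 n
  exact @Resolution.isIntegrallyClosed_of_isRegularLocalRing _ _
    (isRegularLocalRing_stalk_of_smoothOfRelativeDimension (powOver.base C.hom n) (n * 1) t)

omit [CharZero K] [IsIntegral C.left] in
/-- `Ê(x ≫ f ≫ (Cᵍ → C⁽ᵍ⁾)) = Σⱼ[(x ≫ f)ⱼ]` (reassociated `liftDiv_comp_mk`). [folklore] -/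
theorem liftDiv_comp_comp_mk {B : SchemeOver K} (x : AlgPoints B K) (f : B ⟶ powC C g) :
    liftDiv C g hC (x ≫ f ≫ symPowProj.mk C hC g) = coordDivisorAt C g (strPt (K := K) K) (x ≫ f) := by
  rw [← Category.assoc, liftDiv_comp_mk]

/-! #### The shared family `Σⱼ pr*_{uⱼ}Δ + Σᵢ [Aᵢ] − Σⱼ pr*_{u'ⱼ}Δ − Σᵢ [Bᵢ]` -/

omit [IsAlgClosed K] [CharZero K] in
/-- `h⁰` of the shared family on `C × (B × Cᵍ)` whose negative maps start with the coordinates of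
the last factor `Cᵍ`, over a `K`-point `β`: `ℓ(Σ[β ≫ u] + Σ[A] − Σ[B] − Σⱼ[(β ≫ snd)ⱼ])`, the
shape required by the master theorem. [folklore] -/
theorem h0_family (B : SchemeOver K) [IsIntegral (C ⊗ (B ⊗ powC C g)).left]
    {M M' a b : ℕ} (u : Fin M → (B ⊗ powC C g ⟶ C)) (u' : Fin M' → (B ⊗ powC C g ⟶ C))
    (A : Fin a → AlgPoints C K) (Bn : Fin b → AlgPoints C K) (β : AlgPoints (B ⊗ powC C g) K) :
    letI := fibreOverField C (strPt (K := K) K)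
    (((sumDivisor fun m ↦ (diagonalDivisor C).classPullback
        (C ◁ Fin.append u (fun i ↦ const C _ (A i)) m).left) +
      -(sumDivisor fun m ↦ (diagonalDivisor C).classPullback
        (C ◁ Fin.append (Fin.append (fun j ↦ snd B (powC C g) ≫ coord C g j) u')
          (fun i ↦ const C _ (Bn i)) m).left)).classPullback (C ◁ β).left).h0 K =
      ell (((∑ m, ptDiv C (β ≫ u m)) + tupleDiv C A - ((∑ m, ptDiv C (β ≫ u' m)) + tupleDiv C Bn)) -
        coordDivisorAt C g (strPt (K := K) K) (β ≫ snd B (powC C g))) := by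
  rw [h0_signedFamily_append_const]
  congr 1
  simp only [Fin.sum_univ_add, Fin.append_left, Fin.append_right, coordDivisorAt, ptDiv, Category.assoc]
  abel

include hX hg in
/-- **Translation morphisms `E ↦ E'` with `E' ∼ E + Σ[A] − Σ[B]`** (`#A = #B`). On an open
`Ω ⊆ C⁽ᵍ⁾` on whose `K`-points `ℓ(Ê(y) + Σ[A] − Σ[B]) = 1`, there is a morphism `ψ : Ω → C⁽ᵍ⁾`
sending each `K`-point `y` to the unique effective divisor linearly equivalent to
`Ê(y) + Σ[A] − Σ[B]` (the transition maps of Weil's charts and, with `Ω ⊆ W`, Milne's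
translation maps). [cite: Milne1986JacobianVarieties, §7 (Weil's construction) and §5 Thm. 5.1 (a)] -/
theorem exists_hom_translate {a b : ℕ} (A : Fin a → AlgPoints C K) (Bn : Fin b → AlgPoints C K)
    (hab : a = b) (Ω : (symPowProj C hC g).left.Opens) (hΩ₀ : (Ω : Set (symPowProj C hC g).left).Nonempty)
    (hΩ : ∀ y : AlgPoints (symPowProj C hC g) K, y.pt ∈ Ω →
      ell (liftDiv C g hC y + tupleDiv C A - tupleDiv C Bn) = 1) :
    ∃ ψ : Over.mk (Ω.ι ≫ (symPowProj C hC g).hom) ⟶ symPowProj C hC g,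
      ∀ (t : AlgPoints (Over.mk (Ω.ι ≫ (symPowProj C hC g).hom)) K) (R : Fin g → AlgPoints C K),
        Divisor.IsLinearlyEquivalent (tupleDiv C R)
          (liftDiv C g hC (t ≫ Over.homMk Ω.ι rfl) + tupleDiv C A - tupleDiv C Bn) →
        t ≫ ψ = tuplePt C (strPt (K := K) K) R ≫ symPowProj.mk C hC g := by
  haveI := symPowProj.isIntegral_left C hC g
  haveI := symPowProj.locallyOfFiniteType_hom C hC g
  haveI := symPowProj.isProper_hom C hC g
  haveI := symPowProj.surjective_mk_left C hC g
  haveI := symPowProj.isFinite_mk_left C hC g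
  haveI := isIntegral_powC_tensor_powC_left C g g
  haveI := isIntegral_tensor_powC_tensor_powC_left C g g
  let D : CartierDivisor (C ⊗ (powC C g ⊗ powC C g)).left :=
    (sumDivisor fun m ↦ (diagonalDivisor C).classPullback
        (C ◁ Fin.append (fun j ↦ fst (powC C g) (powC C g) ≫ coord C g j)
          (fun i ↦ const C _ (A i)) m).left) +
      -(sumDivisor fun m ↦ (diagonalDivisor C).classPullback
        (C ◁ Fin.append (Fin.append (fun j ↦ snd (powC C g) (powC C g) ≫ coord C g j)
          (Fin.elim0 : Fin 0 → (powC C g ⊗ powC C g ⟶ C))) (fun i ↦ const C _ (Bn i)) m).left)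
  obtain ⟨ψ, hψ⟩ := exists_hom_symPowProj_of_family_opens C hC hX g (symPowProj C hC g) Ω hΩ₀
    (fun t _ ↦ symPowProj.isIntegrallyClosed_stalk C hC 1 g t) (powC C g) (symPowProj.mk C hC g) D
    (fun y ↦ liftDiv C g hC y + tupleDiv C A - tupleDiv C Bn)
    (fun β ↦ by
      rw [h0_family, liftDiv_comp_comp_mk]
      simp only [Finset.univ_eq_empty, Finset.sum_empty, zero_add, coordDivisorAt, ptDiv, Category.assoc])
    (fun t ↦ by
      rw [map_sub, map_add, degree_liftDiv, degree_tupleDiv, degree_tupleDiv, hab]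
      ring)
    hΩ hg
  exact ⟨ψ, fun t R h ↦ hψ t R (by rw [coordDivisorAt_tuplePt_eq_tupleDiv]; exact h)⟩

include hX hg in
/-- **Reflection morphisms `E ↦ E'` with `E' ∼ −E + Σ[A] − Σ[B]`** (`#A = #B + 2g`), on an open
`Ω ⊆ C⁽ᵍ⁾` on whose `K`-points `ℓ(−Ê(y) + Σ[A] − Σ[B]) = 1` (the inverse of Weil's group law
in charts). [cite: Milne1986JacobianVarieties, §7 (Weil's construction)] -/
theorem exists_hom_reflect {a b : ℕ} (A : Fin a → AlgPoints C K) (Bn : Fin b → AlgPoints C K)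
    (hab : a = b + 2 * g) (Ω : (symPowProj C hC g).left.Opens)
    (hΩ₀ : (Ω : Set (symPowProj C hC g).left).Nonempty)
    (hΩ : ∀ y : AlgPoints (symPowProj C hC g) K, y.pt ∈ Ω →
      ell (-liftDiv C g hC y + tupleDiv C A - tupleDiv C Bn) = 1) :
    ∃ ψ : Over.mk (Ω.ι ≫ (symPowProj C hC g).hom) ⟶ symPowProj C hC g,
      ∀ (t : AlgPoints (Over.mk (Ω.ι ≫ (symPowProj C hC g).hom)) K) (R : Fin g → AlgPoints C K),
        Divisor.IsLinearlyEquivalent (tupleDiv C R)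
          (-liftDiv C g hC (t ≫ Over.homMk Ω.ι rfl) + tupleDiv C A - tupleDiv C Bn) →
        t ≫ ψ = tuplePt C (strPt (K := K) K) R ≫ symPowProj.mk C hC g := by
  haveI := symPowProj.isIntegral_left C hC g
  haveI := symPowProj.locallyOfFiniteType_hom C hC g
  haveI := symPowProj.isProper_hom C hC g
  haveI := symPowProj.surjective_mk_left C hC g
  haveI := symPowProj.isFinite_mk_left C hC g
  haveI := isIntegral_powC_tensor_powC_left C g g
  haveI := isIntegral_tensor_powC_tensor_powC_left C g g
  let D : CartierDivisor (C ⊗ (powC C g ⊗ powC C g)).left :=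
    (sumDivisor fun m ↦ (diagonalDivisor C).classPullback
        (C ◁ Fin.append (Fin.elim0 : Fin 0 → (powC C g ⊗ powC C g ⟶ C))
          (fun i ↦ const C _ (A i)) m).left) +
      -(sumDivisor fun m ↦ (diagonalDivisor C).classPullback
        (C ◁ Fin.append (Fin.append (fun j ↦ snd (powC C g) (powC C g) ≫ coord C g j)
          (fun j ↦ fst (powC C g) (powC C g) ≫ coord C g j)) (fun i ↦ const C _ (Bn i)) m).left)
  obtain ⟨ψ, hψ⟩ := exists_hom_symPowProj_of_family_opens C hC hX g (symPowProj C hC g) Ω hΩ₀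
    (fun t _ ↦ symPowProj.isIntegrallyClosed_stalk C hC 1 g t) (powC C g) (symPowProj.mk C hC g) D
    (fun y ↦ -liftDiv C g hC y + tupleDiv C A - tupleDiv C Bn)
    (fun β ↦ by
      rw [h0_family, liftDiv_comp_comp_mk]
      simp only [Finset.univ_eq_empty, Finset.sum_empty, zero_add, coordDivisorAt, ptDiv, Category.assoc]
      congr 1
      abel)
    (fun t ↦ by
      rw [map_sub, map_add, map_neg, degree_liftDiv, degree_tupleDiv, degree_tupleDiv, hab]
      push_cast
      ring)
    hΩ hg
  exact ⟨ψ, fun t R h ↦ hψ t R (by rw [coordDivisorAt_tuplePt_eq_tupleDiv]; exact h)⟩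

include hX hg in
/-- **Addition morphisms `(E, F) ↦ E''` with `E'' ∼ E + F + Σ[A] − Σ[B]`** (`#B = #A + g`), on an
open `Ω ⊆ C⁽ᵍ⁾ × C⁽ᵍ⁾` on whose `K`-points `ℓ(Ê(y₁) + Ê(y₂) + Σ[A] − Σ[B]) = 1` (Weil's group law
in charts). [cite: Milne1986JacobianVarieties, §7 (Weil's construction)] -/
theorem exists_hom_add {a b : ℕ} (A : Fin a → AlgPoints C K) (Bn : Fin b → AlgPoints C K)
    (hab : b = a + g) (Ω : (symPowProj C hC g ⊗ symPowProj C hC g).left.Opens)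
    (hΩ₀ : (Ω : Set (symPowProj C hC g ⊗ symPowProj C hC g).left).Nonempty)
    (hΩ : ∀ w : AlgPoints (symPowProj C hC g ⊗ symPowProj C hC g) K, w.pt ∈ Ω →
      ell (liftDiv C g hC (w ≫ fst _ _) + liftDiv C g hC (w ≫ snd _ _) + tupleDiv C A - tupleDiv C Bn) = 1) :
    ∃ ψ : Over.mk (Ω.ι ≫ (symPowProj C hC g ⊗ symPowProj C hC g).hom) ⟶ symPowProj C hC g,
      ∀ (t : AlgPoints (Over.mk (Ω.ι ≫ (symPowProj C hC g ⊗ symPowProj C hC g).hom)) K)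
        (R : Fin g → AlgPoints C K),
        Divisor.IsLinearlyEquivalent (tupleDiv C R)
          (liftDiv C g hC (t ≫ Over.homMk Ω.ι rfl ≫ fst _ _) +
            liftDiv C g hC (t ≫ Over.homMk Ω.ι rfl ≫ snd _ _) + tupleDiv C A - tupleDiv C Bn) →
        t ≫ ψ = tuplePt C (strPt (K := K) K) R ≫ symPowProj.mk C hC g := by
  haveI := symPowProj.isIntegral_left C hC g
  haveI := symPowProj.locallyOfFiniteType_hom C hC g
  haveI := symPowProj.isProper_hom C hC g
  haveI := symPowProj.surjective_mk_left C hC g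
  haveI := symPowProj.isFinite_mk_left C hC g
  haveI := isIntegral_symPowProj_tensor_left C hC g
  haveI := isIntegral_powC_tensor_powC_left C g g
  haveI := isIntegral_powC3_left C g g g
  haveI := isIntegral_tensor_powC3_left C g g g
  haveI : UniversallyClosed (symPowProj.mk C hC g ⊗ₘ symPowProj.mk C hC g).left :=
    universallyClosed_tensorHom_left _ _
  haveI : Surjective (symPowProj.mk C hC g ⊗ₘ symPowProj.mk C hC g).left := surjective_tensorHom_left _ _
  let D : CartierDivisor (C ⊗ ((powC C g ⊗ powC C g) ⊗ powC C g)).left :=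
    (sumDivisor fun m ↦ (diagonalDivisor C).classPullback
        (C ◁ Fin.append (Fin.append (fun j ↦ fst _ (powC C g) ≫ fst (powC C g) (powC C g) ≫ coord C g j)
          (fun j ↦ fst _ (powC C g) ≫ snd (powC C g) (powC C g) ≫ coord C g j))
          (fun i ↦ const C _ (A i)) m).left) +
      -(sumDivisor fun m ↦ (diagonalDivisor C).classPullback
        (C ◁ Fin.append (Fin.append (fun j ↦ snd (powC C g ⊗ powC C g) (powC C g) ≫ coord C g j)
          (Fin.elim0 : Fin 0 → ((powC C g ⊗ powC C g) ⊗ powC C g ⟶ C))) (fun i ↦ const C _ (Bn i)) m).left)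
  obtain ⟨ψ, hψ⟩ := exists_hom_symPowProj_of_family_opens C hC hX g
    (symPowProj C hC g ⊗ symPowProj C hC g) Ω hΩ₀
    (fun t _ ↦ symPowProj.isIntegrallyClosed_stalk_tensor C hC 1 g g t) (powC C g ⊗ powC C g)
    (symPowProj.mk C hC g ⊗ₘ symPowProj.mk C hC g) D
    (fun w ↦ liftDiv C g hC (w ≫ fst _ _) + liftDiv C g hC (w ≫ snd _ _) + tupleDiv C A - tupleDiv C Bn)
    (fun β ↦ by
      rw [h0_family]
      simp only [Category.assoc, tensorHom_fst, tensorHom_snd]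
      simp only [← Category.assoc]
      rw [liftDiv_comp_mk, liftDiv_comp_mk]
      simp only [Finset.univ_eq_empty, Finset.sum_empty, zero_add, coordDivisorAt, ptDiv,
        Fin.sum_univ_add, Fin.append_left, Fin.append_right, Category.assoc])
    (fun t ↦ by
      rw [map_sub, map_add, map_add, degree_liftDiv, degree_liftDiv, degree_tupleDiv, degree_tupleDiv, hab]
      push_cast
      ring)
    hΩ hg
  refine ⟨ψ, fun t R h ↦ hψ t R ?_⟩
  rw [coordDivisorAt_tuplePt_eq_tupleDiv, Category.assoc, Category.assoc]
  exact h

include hX hg in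
/-- **Symmetrisation morphisms `(P₁, …, P_g) ↦ E'` with `E' ∼ Σ[Pⱼ] + Σ[A] − Σ[B]`** (`#A = #B`),
on an open `Ω ⊆ Cᵍ` on whose `K`-points `ℓ(Σ[Pⱼ] + Σ[A] − Σ[B]) = 1` (Weil's `Cᵍ → J` in
charts; `Cᵍ` is smooth, hence normal). [cite: Milne1986JacobianVarieties, §7 (Weil's construction) and §5] -/
theorem exists_hom_symmetrize {a b : ℕ} (A : Fin a → AlgPoints C K) (Bn : Fin b → AlgPoints C K)
    (hab : a = b) (Ω : (powC C g).left.Opens) (hΩ₀ : (Ω : Set (powC C g).left).Nonempty)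
    (hΩ : ∀ τ : AlgPoints (powC C g) K, τ.pt ∈ Ω →
      ell (coordDivisorAt C g (strPt (K := K) K) τ + tupleDiv C A - tupleDiv C Bn) = 1) :
    ∃ ψ : Over.mk (Ω.ι ≫ (powC C g).hom) ⟶ symPowProj C hC g,
      ∀ (t : AlgPoints (Over.mk (Ω.ι ≫ (powC C g).hom)) K) (R : Fin g → AlgPoints C K),
        Divisor.IsLinearlyEquivalent (tupleDiv C R)
          (coordDivisorAt C g (strPt (K := K) K) (t ≫ Over.homMk Ω.ι rfl) + tupleDiv C A - tupleDiv C Bn) →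
        t ≫ ψ = tuplePt C (strPt (K := K) K) R ≫ symPowProj.mk C hC g := by
  haveI := isIntegral_powC_tensor_powC_left C g g
  haveI := isIntegral_tensor_powC_tensor_powC_left C g g
  let D : CartierDivisor (C ⊗ (powC C g ⊗ powC C g)).left :=
    (sumDivisor fun m ↦ (diagonalDivisor C).classPullback
        (C ◁ Fin.append (fun j ↦ fst (powC C g) (powC C g) ≫ coord C g j)
          (fun i ↦ const C _ (A i)) m).left) +
      -(sumDivisor fun m ↦ (diagonalDivisor C).classPullback
        (C ◁ Fin.append (Fin.append (fun j ↦ snd (powC C g) (powC C g) ≫ coord C g j)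
          (Fin.elim0 : Fin 0 → (powC C g ⊗ powC C g ⟶ C))) (fun i ↦ const C _ (Bn i)) m).left)
  obtain ⟨ψ, hψ⟩ := exists_hom_symPowProj_of_family_opens C hC hX g (powC C g) Ω hΩ₀
    (fun t _ ↦ isIntegrallyClosed_stalk_powC C g t) (powC C g) (𝟙 _) D
    (fun τ ↦ coordDivisorAt C g (strPt (K := K) K) τ + tupleDiv C A - tupleDiv C Bn)
    (fun β ↦ by
      rw [h0_family, Category.comp_id]
      simp only [Finset.univ_eq_empty, Finset.sum_empty, zero_add, coordDivisorAt, ptDiv, Category.assoc])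
    (fun t ↦ by
      rw [map_sub, map_add, degree_tupleDiv, degree_tupleDiv, hab]
      have : (coordDivisorAt C g (strPt (K := K) K) t).degree = g := by
        rw [← tuplePt_comp_coord C g _ t, coordDivisorAt_tuplePt_eq_tupleDiv, degree_tupleDiv]
      rw [this]; ring)
    hΩ hg
  exact ⟨ψ, fun t R h ↦ hψ t R (by rw [coordDivisorAt_tuplePt_eq_tupleDiv]; exact h)⟩

include hX in
omit [CharZero K] in
/-- **The open `{(y₁, y₂) ∈ C⁽ᵍ⁾ × C⁽ᵍ⁾ : ℓ(Ê(y₁) − Ê(y₂) + Σ[A] − Σ[B]) ≤ n}`** (on `K`-points; used for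
the closedness of the graphs of Weil's transition maps). [cite: Milne1986JacobianVarieties, §7 (Weil's construction)] -/
theorem exists_opens_tensor_symPowProj_pt_mem_iff_sub (n : ℕ) {a b : ℕ} (A : Fin a → AlgPoints C K)
    (Bn : Fin b → AlgPoints C K) :
    ∃ U : (symPowProj C hC g ⊗ symPowProj C hC g).left.Opens, ∀ R₁ R₂ : Fin g → AlgPoints C K,
      AlgPoints.pt (lift (tuplePt C (strPt (K := K) K) R₁ ≫ symPowProj.mk C hC g)
        (tuplePt C (strPt (K := K) K) R₂ ≫ symPowProj.mk C hC g) :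
          AlgPoints (symPowProj C hC g ⊗ symPowProj C hC g) K) ∈ U ↔
        ell (tupleDiv C R₁ - tupleDiv C R₂ + tupleDiv C A - tupleDiv C Bn) ≤ n := by
  haveI := symPowProj.isProper_hom C hC g
  haveI := symPowProj.locallyOfFiniteType_hom C hC g
  haveI := symPowProj.surjective_mk_left C hC g
  haveI := symPowProj.isFinite_mk_left C hC g
  haveI : UniversallyClosed (symPowProj.mk C hC g ⊗ₘ symPowProj.mk C hC g).left :=
    universallyClosed_tensorHom_left _ _
  haveI : Surjective (symPowProj.mk C hC g ⊗ₘ symPowProj.mk C hC g).left := surjective_tensorHom_left _ _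
  haveI := isIntegral_powC_tensor_powC_left C g g
  haveI := isIntegral_tensor_powC_tensor_powC_left C g g
  let D : CartierDivisor (C ⊗ (powC C g ⊗ powC C g)).left :=
    (sumDivisor fun m ↦ (diagonalDivisor C).classPullback
        (C ◁ Fin.append (fun j ↦ fst (powC C g) (powC C g) ≫ coord C g j)
          (fun i ↦ const C (powC C g ⊗ powC C g) (A i)) m).left) +
      -(sumDivisor fun m ↦ (diagonalDivisor C).classPullback
        (C ◁ Fin.append (fun j ↦ snd (powC C g) (powC C g) ≫ coord C g j)
          (fun i ↦ const C (powC C g ⊗ powC C g) (Bn i)) m).left)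
  obtain ⟨U, hU⟩ := exists_opens_pt_mem_iff_ell_le C hX (symPowProj C hC g ⊗ symPowProj C hC g)
    (powC C g ⊗ powC C g) (symPowProj.mk C hC g ⊗ₘ symPowProj.mk C hC g) D
    (fun w ↦ liftDiv C g hC (w ≫ fst _ _) - liftDiv C g hC (w ≫ snd _ _) + tupleDiv C A - tupleDiv C Bn)
    (fun β ↦ by
      rw [h0_signedFamily_append_const]
      simp only [Category.assoc, tensorHom_fst, tensorHom_snd]
      simp only [← Category.assoc]
      rw [liftDiv_comp_mk, liftDiv_comp_mk]
      simp only [coordDivisorAt, ptDiv, Category.assoc]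
      congr 1
      abel) n
  refine ⟨U, fun R₁ R₂ ↦ ?_⟩
  rw [hU, lift_fst, lift_snd, liftDiv_tuplePt_mk, liftDiv_tuplePt_mk]

omit [CharZero K] [IsIntegral C.left] in
/-- **`K`-points of `C⁽ᵍ⁾` with linearly equivalent divisors `Ê`, one of which has `ℓ = 1`, are
equal** (`|Ê(y)| = {Ê(y)}`). [cite: Milne1986JacobianVarieties, §3 Prop. 3.1 and §5 Thm. 5.1 (a)] -/
theorem symPowProj.algPoints_eq_of_isLinearlyEquivalent {y y' : AlgPoints (symPowProj C hC g) K}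
    (h : (liftDiv C g hC y).IsLinearlyEquivalent (liftDiv C g hC y'))
    (h1 : ell (liftDiv C g hC y) = 1) : y = y' := by
  obtain ⟨R, rfl⟩ := exists_tuplePt_mk_eq C g hC y
  obtain ⟨R', rfl⟩ := exists_tuplePt_mk_eq C g hC y'
  rw [liftDiv_tuplePt_mk, liftDiv_tuplePt_mk] at h
  rw [liftDiv_tuplePt_mk] at h1
  refine tuplePt_mk_eq_of_isLinearlyEquivalent C g hC ?_ ?_
  · rwa [coordDivisorAt_tuplePt_eq_tupleDiv, coordDivisorAt_tuplePt_eq_tupleDiv]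
  · rwa [coordDivisorAt_tuplePt_eq_tupleDiv]

omit [IsAlgClosed K] [CharZero K] [IsIntegral C.left] in
include hg in
/-- **Riemann: a divisor of degree `g ≥ genus` has a section**, `1 ≤ ℓ(D)`. [cite: Stichtenoth2009, Thm. 1.4.17 (a)] -/
theorem one_le_ell_of_degree_eq {D : Divisor K (curveBC C (strPt (K := K) K)).left.functionField}
    (hD : D.degree = g) : 1 ≤ ell D := by
  have h := degree_add_one_sub_genus_le_ell (K := K) D
  rw [hD] at h
  have : (1 : ℤ) ≤ (ell D : ℤ) := by linarith
  exact_mod_cast this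

end Maps

end Literature.AlgebraicGeometry.Motives

end
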